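import Summits.AtomisticToContinuum.HydrodynamicLimit.Theorems.RelayRaceLocalityNearConstantShortTimeHLTiltDomination
import Literature.Analysis.FluidPDE.BoltzmannGradLimit
import HarnessLib

/-!
# Crux `NearConstantShortTimeHL` (stmt-AtomisticToContinuum-12502), line `small-tilt-domination` — event import by domination

Lead c2, internal lemma (P2) of `stub_meanFieldGronwall`: pointwise domination of canonical densities (the landed
`stub_smallTiltDomination : TiltDomination`) is domination of the particle LAWS as measures, for every hard-sphere flow and
every (not necessarily measurable) event; hence every trajectory event of the near-constant local Gibbs law is at most
`e^{C δ n}` times its probability under the invariant drifted Gibbs law.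
-/

noncomputable section

namespace Summit.AtomisticToContinuum.HydrodynamicLimit.Theorems.NearConstantShortTimeHL

open scoped BigOperators ENNReal
open MeasureTheory Set Filter
open Literature.MathematicalPhysics.KineticTheory Literature.Analysis.FluidPDE Literature.Analysis.FunctionSpaces

/-- **Domination of densities is domination of laws.** If two one-particle profiles give canonical densities with
`cd f₀ ≤ c · cd f₁` pointwise (`0 ≤ c`), then for every flow `Φ` and EVERY set `A` of configurations,
`particleLaw Φ (cd f₀) A ≤ ofReal c * particleLaw Φ (cd f₁) A`. [folklore] -/
theorem particleLaw_apply_le_of_canonicalDensity_le {ε : ℝ} {n : ℕ}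
    (Φ : HardSphereFlow (Torus.geometry (Fin 3)) ε n) {f₀ f₁ : T3 × V3 → ℝ} {c : ℝ} (hc : 0 ≤ c)
    (hle : ∀ z, canonicalDensity (Torus.geometry (Fin 3)) ε n f₀ z ≤
      c * canonicalDensity (Torus.geometry (Fin 3)) ε n f₁ z)
    (A : Set (Config n (Fin 3) T3)) :
    particleLaw Φ (canonicalDensity (Torus.geometry (Fin 3)) ε n f₀) A ≤
      ENNReal.ofReal c * particleLaw Φ (canonicalDensity (Torus.geometry (Fin 3)) ε n f₁) A := by
  -- instance shortcuts (the search for `SigmaFinite` on configuration spaces is deep)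
  haveI : SigmaFinite (volume : Measure (T3 × V3)) := inferInstance
  haveI : SigmaFinite (volume : Measure (Config n (Fin 3) T3)) := inferInstance
  haveI : SFinite (liouville (Torus.geometry (Fin 3)) n ε) := by rw [liouville_eq]; infer_instance
  rw [particleLaw_eq, particleLaw_eq, withDensity_apply' _ A, withDensity_apply' _ A,
    ← lintegral_const_mul' _ _ ENNReal.ofReal_ne_top]
  refine lintegral_mono fun z => ?_
  rw [← ENNReal.ofReal_mul hc]
  exact ENNReal.ofReal_le_ofReal (hle z)

/-- **EVENT IMPORT** (line `small-tilt-domination`, S5b step 2): under the hypotheses of `TiltDomination` at `(M, δ)` — a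
profile `(a₀, u₀, θ₀)` that is `δ`-close to the boxed constants `(abar, ubar, θbar)` — every event `A` of `n` spheres of diameter
`ε` has, under the canonical local Gibbs law of `(a₀, u₀, θ₀)`, probability at most `e^{C δ n}` times its probability under the
INVARIANT drifted Gibbs law of the constant profile `(abar e^{δ}, ubar, θbar (1 + 2δ))`. [cite: Yau1991, §2] -/
theorem eventImport_of_tiltDomination : TiltDomination → ∀ {M : ℝ}, 1 ≤ M →
    ∃ C : ℝ, 0 < C ∧ ∀ δ : ℝ, 0 < δ → δ ≤ 1 / 2 →
    ∀ (abar θbar : ℝ) (ubar : V3), M⁻¹ ≤ abar → abar ≤ M → M⁻¹ ≤ θbar → θbar ≤ M → ‖ubar‖ ≤ M →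
    ∀ (a₀ θ₀ : T3 → ℝ) (u₀ : T3 → V3), Continuous a₀ → Continuous θ₀ → Continuous u₀ →
    (∀ x, 0 < a₀ x ∧ |Real.log (a₀ x / abar)| ≤ δ ∧ ‖u₀ x - ubar‖ ≤ δ ∧ |θ₀ x - θbar| ≤ δ * θbar) →
    ∀ (ε : ℝ), 0 < ε → ∀ (n : ℕ) (Φ : HardSphereFlow (Torus.geometry (Fin 3)) ε n) (A : Set (Config n (Fin 3) T3)),
      particleLaw Φ (canonicalDensity (Torus.geometry (Fin 3)) ε n (localGibbsProfile a₀ u₀ θ₀)) A ≤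
        ENNReal.ofReal (Real.exp (C * δ * n)) *
          particleLaw Φ (canonicalDensity (Torus.geometry (Fin 3)) ε n
            (localGibbsProfile (fun _ => abar * Real.exp δ) (fun _ => ubar) (fun _ => θbar * (1 + 2 * δ)))) A := by
  intro hTD M hM
  obtain ⟨C, hC, H⟩ := hTD M hM
  refine ⟨C, hC, fun δ hδ hδ2 abar θbar ubar h1 h2 h3 h4 h5 a₀ θ₀ u₀ ha hθ hu hclose ε hε n Φ A => ?_⟩
  exact particleLaw_apply_le_of_canonicalDensity_le Φ (Real.exp_pos _).le
    (H δ hδ hδ2 abar θbar ubar h1 h2 h3 h4 h5 a₀ θ₀ u₀ ha hθ hu hclose ε hε n) A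

end Summit.AtomisticToContinuum.HydrodynamicLimit.Theorems.NearConstantShortTimeHL

end
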